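import Literature.AlgebraicGeometry.AbelianVarieties.PoincareSheafSlices
import Literature.AlgebraicGeometry.AbelianVarieties.TheoremOfTheSquareCechPic
import Literature.AlgebraicGeometry.AbelianSchemes.AbelianSchemeDualPair
import Literature.AlgebraicGeometry.Motives.AbelianVarietyConjugate
import Literature.AlgebraicGeometry.Motives.AbelianVarietyQuotientAction
import Literature.AlgebraicGeometry.Motives.CurveLinearSystemMorphism
import HarnessLib

/-!
# The Poincaré sheaf of `(A, Θ)` over `ℂ` lies fibrewise in `Pic⁰` at EVERY geometric point of `Â`

Layer `Literature/AlgebraicGeometry/AbelianVarieties`, namespace `Literature.AlgebraicGeometry.AbelianVarieties`.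
THEOREMS ONLY; no definition, no named fact, no instance, no notation. Cell `hodgecm-mathlib` (D-0151), M1PRIME-DAG
rung 0, U-DAG §2 U-a3 sub-row «`fibrewisePicZero` at Ω-points» (B-p16 lineage; B-plan1 R72).

For a complex abelian variety `A`, an ample Cartier divisor `Θ`, `Â = A/K(Θ)` (★ `dualOf`) and ANY line bundle `𝒫` on
`A × Â` with `(1 × φ_Θ)^*𝒫 ≅ Λ(𝒪(Θ))` (e.g. the normalised Poincaré sheaf ★ `exists_poincareSheaf_normalised`), the
field `fibrewisePicZero` of the tree's `AbelianSchemes.AbelianSchemeOver.DualPair` for the pair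
`(ofAbelianVariety A, ofAbelianVariety Â, 𝒫)` AS TYPED — at every geometric point `b : Spec Ω → Â`, `Ω` ANY
algebraically closed field (the case `Ω = ℂ` is ★ `isHomogeneous_pullback_sliceAt`, whose recorded caveat P43 was
exactly the all-`Ω` form):

* `cechPic_pullback_hom_comp_point_eq_one` — the class of `𝒪(Θ)` along the constant `A_L`-valued point
  `A_L → Spec L →ᵃ A` is trivial (any field extension `L/K`);
* `cechPic_pullback_slice_mk_mumfordCocycle` — **`[Λ(𝒪(Θ))|_{A_L × {a}}] = t_a^*c · c⁻¹`**, `c = pr₁^*[𝒪(Θ)]`, for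
  an `L`-valued point `a ∈ A(L)` ([MumfordAV1970] §8 «`Λ(L)|_{X × {a}} ≅ T_a^*L ⊗ L⁻¹`», read on `A_L` for a point `a`
  rational over the EXTENSION `L`);
* `cechPic_pullback_translation_mul_inv_self` — `t_a^*c · c⁻¹` is translation invariant (theorem of the square,
  ★ `theoremOfTheSquare_holds`, over any field);
* `isHomogeneous_pullback_slice_mumfordSheaf` — `Λ(𝒪(Θ))|_{A_L × {a}} ∈ Pic⁰(A_L)` for every `a ∈ A(L)`;
* `exists_points_comp_phiTheta_eq` — every `L`-valued point of `Â` lifts along `φ_Θ` to an `L`-valued point of `A`,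
  `L ⊇ ℂ` algebraically closed (`φ_Θ` is an isogeny; ★ `IsIsogeny.baseChange`, ★ `AlgPoints.exists_comp_eq_of_surjective`);
* `isHomogeneous_pullback_slice_baseChange` — `𝒫|_{A_L × {b}} ∈ Pic⁰(A_L)` for `b : Spec L → Â` over `Spec L → Spec ℂ`;
* **`fibrewisePicZero_ofAbelianVariety_dualOf`** — the `DualPair` field verbatim:
  `IsHomogeneous ((ofAbelianVariety A).fibre (b ≫ π̂)).toAbelianVariety ((fibreSlice Â b)^* 𝒫)` for all `Ω`, `b`.

After this file the only field of a `DualPair` over `Spec ℂ` for `(A, A/K(Θ), 𝒫)` not in the tree is `universal` on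
non-normal / non-reduced test schemes (`universal` for integral normal `T` locally of finite type is ★
`exists_unique_classify_of_normal`). Banked capital; HC_CM is proved only modulo the 7 printed citations until rung 0
closes.

## References

* [MumfordAV1970] D. Mumford, *Abelian Varieties* (1970), §6 Cor. 4 (theorem of the square), §8 pp. 74–80
  (`Λ(L)`, `P|_{X × {φ_L(a)}} ≅ T_a^*L ⊗ L⁻¹`, the definition of `Pic⁰` (i)⇔(iv)).
* [MilneAV2008] J. S. Milne, *Abelian Varieties* (2008), I §8 pp. 36–40 (condition (a) of the dual pair at all points
  of `A^∨`, Prop. 8.14: `λ_L` is surjective for `L` ample).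
* [GortzWedhorn2020] U. Görtz, T. Wedhorn, *Algebraic Geometry I*, 2nd ed. (2020), Section (4.7) (base change,
  points of `X ×_k L`), Prop. 11.21 (p. 374).
* [Hartshorne1977] R. Hartshorne, *Algebraic Geometry* (1977), II Ex. 6.8 (functoriality of `f^*` on `Pic`).
-/

noncomputable section

open CategoryTheory CategoryTheory.Limits AlgebraicGeometry MonoidalCategory CartesianMonoidalCategory
open Literature.AlgebraicGeometry.Motives Literature.AlgebraicGeometry.Modules
open Literature.AlgebraicGeometry.AbelianSchemes
open scoped MonObj

universe u

namespace Literature.AlgebraicGeometry.AbelianVarieties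

/-! ### §0 Plumbing: `f^* g^* = (f ≫ g)^*` on `Ȟ¹(–, 𝒪^×)` -/

/-- `f^*(g^*x) = (f ≫ g)^*x` on `Ȟ¹(·, 𝒪^×)` (★ `CechPic.pullback_comp` of `Modules/UnitCocyclePresented`, re-derived
privately from `detClass_pullback` to keep the import cone small, as in ★ `AbelianSchemeIsLambdaOfAtBaseChange`).
[cite: Hartshorne1977, II Ex. 6.8 (a)] -/
private theorem cechPic_pullback_pullback {X Y Z : Scheme.{u}} (f : X ⟶ Y) (g : Y ⟶ Z) (x : CechPic Z) :
    CechPic.pullback f (CechPic.pullback g x) = CechPic.pullback (f ≫ g) x := by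
  obtain ⟨c, rfl⟩ := CechPic.mk_surjective x
  have hE := c.isFiniteLocallyFree_lineBundle
  rw [← c.detClass_lineBundle, ← detClass_pullback, ← detClass_pullback, ← detClass_pullback]
  exact (detClass_eq_of_iso ((Scheme.Modules.pullbackComp f g).app (lineBundle c)).symm _ _).symm

/-! ### §1 The slice `Λ(𝒪(Θ))|_{A_L × {a}}` at an `L`-valued point `a ∈ A(L)`, any field extension `L/K`

The projection `π = pr₁ : A_L → A` and the slice `G = (pr₁, a ∘ pr₂) : A_L → A × A` are passed as variables typed
on `(A.baseChange L).X.left` together with their defining equations (the design of ★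
`AbelianVarietyWeilPairingBaseChange` / ★ `AbelianSchemeIsLambdaOfAtConjugate`), so that the classes below all
live in `Ȟ¹((A.baseChange L).X.left, 𝒪^×)` on the nose. -/

section Slice

variable {K : Type u} [Field K] (L : Type u) [Field L] [Algebra K L] (A : AbelianVariety K)
  (Θ : CartierDivisor A.X.left)

/-- **The class of `𝒪(Θ)` along the constant `A_L`-valued point `A_L → Spec L →ᵃ A` is trivial**: the map is
constant (it factors through the one-point space `Spec L`), so the pulled-back divisor class is `0` (★
`CartierDivisor.classPullback_linEquiv_zero_of_const`; `A`, `A_L` integral). [cite: GortzWedhorn2020, Section (4.7) and Prop. 11.21 (p. 374)] -/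
theorem cechPic_pullback_hom_comp_point_eq_one (a : A.Points L) :
    CechPic.pullback ((A.baseChange L).X.hom ≫ a.left) Θ.cechClass = 1 := by
  have hconst : ∀ y y' : ↥(A.baseChange L).X.left,
      ((A.baseChange L).X.hom ≫ a.left) y = ((A.baseChange L).X.hom ≫ a.left) y' := by
    intro y y'
    rw [Scheme.Hom.comp_apply, Scheme.Hom.comp_apply]
    congr 1
    exact Subsingleton.elim (α := ↥(Spec (CommRingCat.of L))) _ _
  rw [CartierDivisor.pullback_cechClass_eq_cechClass_classPullback,
    (CartierDivisor.classPullback_linEquiv_zero_of_const _ hconst Θ).cechClass_eq, CartierDivisor.cechClass_zero]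

/-- **`[Λ(𝒪(Θ))|_{A_L × {a}}] = t_a^*c · c⁻¹` with `c = pr₁^*[𝒪(Θ)] ∈ Ȟ¹(A_L, 𝒪^×)`**, for an `L`-valued point
`a ∈ A(L)` and the slice `G = (pr₁, a ∘ pr₂) : A_L → A × A`: `[Λ|G] = (pr₁ · a∘pr₂)^*[Θ] · (pr₁^*[Θ])⁻¹ · ((a∘pr₂)^*[Θ])⁻¹`
(`Λ = m^*𝒪(Θ) ⊗ p₁^*𝒪(Θ)⁻¹ ⊗ p₂^*𝒪(Θ)⁻¹`, ★ `mk_mumfordCocycle`), the last factor is trivial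
(`cechPic_pullback_hom_comp_point_eq_one`) and `(a∘pr₂) · pr₁ = t_a ≫ pr₁` (★ `transl_fst`: the translation of `A_L`
by `a` read on `A_L`-valued points of `A`).  This is [MumfordAV1970] §8 «`Λ(L)|_{X × {a}} ≅ T_a^*L ⊗ L⁻¹`» at a point
`a` rational over the EXTENSION `L`. [cite: MumfordAV1970, §8 (pp. 78–80)] [cite: GortzWedhorn2020, Section (4.7)] -/
theorem cechPic_pullback_slice_mk_mumfordCocycle (a : A.Points L) (π : (A.baseChange L).X.left ⟶ A.X.left)
    (hπ : π = pullback.fst A.X.hom (AbelianVariety.bcSpec K L)) (G : (A.baseChange L).X.left ⟶ (A.X ⊗ A.X).left)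
    (hG₁ : G ≫ (fst A.X A.X).left = π) (hG₂ : G ≫ (snd A.X A.X).left = (A.baseChange L).X.hom ≫ a.left) :
    CechPic.pullback G (CechPic.mk (mumfordCocycle A Θ)) =
      CechPic.pullback ((A.baseChange L).translation (A.pointsMulEquiv L a)).left (CechPic.pullback π Θ.cechClass) *
        (CechPic.pullback π Θ.cechClass)⁻¹ := by
  -- `G` is the pair `G♯ = (pr₁, a∘pr₂)` of `A_L`-valued points of `A` (compared through `exact`: the source of `G♯`
  -- is `A_L` regarded over `K`, definitionally but not syntactically `(A.baseChange L).X.left`)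
  have hGeq : G = (lift (A.fstPt L) (A.constPt L a)).left := by
    apply pullback.hom_ext
    · exact (hG₁.trans hπ).trans (congrArg CommaMorphism.left (lift_fst (A.fstPt L) (A.constPt L a))).symm
    · exact hG₂.trans (congrArg CommaMorphism.left (lift_snd (A.fstPt L) (A.constPt L a))).symm
  -- `m ∘ G = (a∘pr₂) · pr₁ = t_a ≫ pr₁`
  have h3 : G ≫ (fst A.X A.X * snd A.X A.X).left =
      ((A.baseChange L).translation (A.pointsMulEquiv L a)).left ≫ π := by
    have e0 : lift (A.fstPt L) (A.constPt L a) ≫ (fst A.X A.X * snd A.X A.X) = A.constPt L a * A.fstPt L := by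
      rw [MonObj.comp_mul, lift_fst, lift_snd, mul_comm]
    have e1 : A.transl L a ≫ pullback.fst A.X.hom (AbelianVariety.bcSpec K L) =
        ((A.baseChange L).translation (A.pointsMulEquiv L a)).left ≫ π := by
      rw [hπ]; rfl
    rw [hGeq]
    exact (congrArg CommaMorphism.left e0).trans ((A.transl_fst L a).symm.trans e1)
  rw [mk_mumfordCocycle, map_mul, map_inv, map_mul, cechPic_pullback_pullback, cechPic_pullback_pullback,
    cechPic_pullback_pullback, h3, hG₁, hG₂, cechPic_pullback_hom_comp_point_eq_one, mul_one,
    ← cechPic_pullback_pullback]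

end Slice

/-! ### §2 `t_a^*c · c⁻¹` is translation invariant (theorem of the square over any field) -/

section Square

variable {K : Type u} [Field K] (B : AbelianVariety K)

/-- **`t_x^*(t_a^*c · c⁻¹) = t_a^*c · c⁻¹`** for all rational points `a, x` of an abelian variety `B` over any field
and every class `c ∈ Ȟ¹(B, 𝒪^×)` — the theorem of the square `t_{ax}^*c · c = t_a^*c · t_x^*c` (★
`theoremOfTheSquare_holds`, ★ `pullback_translation_mul_mul_self`) rearranged; i.e. `t_a^*L ⊗ L⁻¹ ∈ Pic⁰(B)`
([MumfordAV1970] §8, definition of `Pic⁰`, (iv) ⇒ (i)). [cite: MumfordAV1970, §6 Cor. 4 (p. 59) and §8 (definition of Pic⁰)] -/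
theorem cechPic_pullback_translation_mul_inv_self (c : CechPic B.X.left) (a x : B.Points K) :
    CechPic.pullback (B.translation x).left (CechPic.pullback (B.translation a).left c * c⁻¹) =
      CechPic.pullback (B.translation a).left c * c⁻¹ := by
  have hsq := pullback_translation_mul_mul_self B B.theoremOfTheSquare_holds c a x
  have ht : (B.translation x).left ≫ (B.translation a).left = (B.translation (a * x)).left := by
    rw [← Over.comp_left, AbelianVariety.translation_comp]
  rw [map_mul, map_inv, cechPic_pullback_pullback, ht, mul_inv_eq_iff_eq_mul, mul_assoc, mul_comm c⁻¹,
    ← mul_assoc, ← hsq, mul_assoc, mul_inv_cancel, mul_one]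

end Square

/-! ### §3 `Λ(𝒪(Θ))|_{A_L × {a}} ∈ Pic⁰(A_L)` -/

section SliceHomogeneous

variable {K : Type u} [Field K] (L : Type u) [Field L] [Algebra K L] (A : AbelianVariety K)
  (Θ : CartierDivisor A.X.left)

/-- **`Λ(𝒪(Θ))|_{A_L × {a}} ∈ Pic⁰(A_L)` for every `L`-valued point `a ∈ A(L)`**, `L/K` any field extension: the
slice of Mumford's sheaf along `G = (pr₁, a∘pr₂) : A_L → A × A` is translation invariant on `A_L` (its class is
`t_a^*c · c⁻¹`, `cechPic_pullback_slice_mk_mumfordCocycle`, fixed by every `t_x^*`,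
`cechPic_pullback_translation_mul_inv_self`; rank-one modules with the same class are isomorphic, ★
`isHomogeneous_iff_forall_pullback_detClass_eq`). [cite: MumfordAV1970, §8 (pp. 74–80)] [cite: MilneAV2008, I §8 (p. 37 (a))] -/
theorem isHomogeneous_pullback_slice_mumfordSheaf (a : A.Points L) (π : (A.baseChange L).X.left ⟶ A.X.left)
    (hπ : π = pullback.fst A.X.hom (AbelianVariety.bcSpec K L)) (G : (A.baseChange L).X.left ⟶ (A.X ⊗ A.X).left)
    (hG₁ : G ≫ (fst A.X A.X).left = π) (hG₂ : G ≫ (snd A.X A.X).left = (A.baseChange L).X.hom ≫ a.left) :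
    IsHomogeneous (A.baseChange L) ((Scheme.Modules.pullback G).obj (mumfordSheaf A Θ)) := by
  refine (isHomogeneous_iff_forall_pullback_detClass_eq (A.baseChange L)
    (hasRank_pullback _ (hasRank_mumfordSheaf A Θ)) ((isFiniteLocallyFree_mumfordSheaf A Θ).pullback _)).2
    fun x => ?_
  -- `[G^*Λ] = G^*[Λ]`
  have hd : detClass ((isFiniteLocallyFree_mumfordSheaf A Θ).pullback G) =
      CechPic.pullback G (CechPic.mk (mumfordCocycle A Θ)) :=
    (detClass_pullback G (isFiniteLocallyFree_mumfordSheaf A Θ)).trans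
      (congrArg (CechPic.pullback G) (mumfordCocycle A Θ).detClass_lineBundle)
  rw [hd, cechPic_pullback_slice_mk_mumfordCocycle L A Θ a π hπ G hG₁ hG₂]
  exact cechPic_pullback_translation_mul_inv_self (A.baseChange L) _ _ x

end SliceHomogeneous

/-! ### §4 The Poincaré sheaf of `(A, Θ)` over `ℂ` at the geometric points of `Â` -/

section Complex

variable (A : AbelianVariety ℂ) {Θ : CartierDivisor A.X.left} (hΘ : Θ.IsAmple)

/-- **Every `L`-valued point of `Â = A/K(Θ)` lifts along `φ_Θ` to an `L`-valued point of `A`**, for `L ⊇ ℂ`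
algebraically closed: `φ_Θ` is an isogeny (★ `isIsogeny_phiTheta`), so is its base change `(φ_Θ)_L` (★
`IsIsogeny.baseChange`), and `L`-points lift along surjective morphisms of `L`-schemes locally of finite type (★
`AlgPoints.exists_comp_eq_of_surjective`); `A(L) = A_L(L)` (★ `pointsEquiv`). [cite: MilneAV2008, I §8 Prop. 8.14 (p. 39)]
[cite: GortzWedhorn2020, Section (4.7) (points of a base change)] -/
theorem exists_points_comp_phiTheta_eq (L : Type) [Field L] [Algebra ℂ L] [IsAlgClosed L]
    (b : (A.dualOf Θ hΘ).Points L) : ∃ a : A.Points L, a ≫ (A.phiTheta Θ hΘ).hom.hom.hom = b := by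
  -- `(φ_Θ)_L` is surjective and `A_L` is of finite type: lift the point of `Â_L` corresponding to `b`
  haveI : Surjective (AbelianVariety.Hom.baseChange L (A.phiTheta Θ hΘ)).hom.hom.hom.left :=
    ((A.isIsogeny_phiTheta hΘ).baseChange L).1
  obtain ⟨x, hx⟩ := AlgPoints.exists_comp_eq_of_surjective
    (AbelianVariety.Hom.baseChange L (A.phiTheta Θ hΘ)).hom.hom.hom ((A.dualOf Θ hΘ).pointsEquiv L b)
  refine ⟨(A.pointsEquiv L).symm x, Over.OverMorphism.ext ?_⟩
  have hx' : x.left ≫ AbelianVariety.Hom.toSchemeHom (AbelianVariety.Hom.baseChange L (A.phiTheta Θ hΘ)) =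
      ((A.dualOf Θ hΘ).pointsEquiv L b).left := by
    rw [← hx, Over.comp_left]
  -- `((x ≫ pr₁) ≫ φ_Θ) = x ≫ (φ_Θ)_L ≫ pr₁ = y ≫ pr₁ = b` on underlying schemes (chained through `Eq.trans`: the
  -- sources `Spec L` of these points are definitionally, not syntactically, equal)
  have h1 : ((A.pointsEquiv L).symm x ≫ (A.phiTheta Θ hΘ).hom.hom.hom).left =
      (x.left ≫ pullback.fst A.X.hom (AbelianVariety.bcSpec ℂ L)) ≫ AbelianVariety.Hom.toSchemeHom (A.phiTheta Θ hΘ) :=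
    congrArg (· ≫ AbelianVariety.Hom.toSchemeHom (A.phiTheta Θ hΘ)) (A.pointsEquiv_symm_apply_left L x)
  have h2 : (x.left ≫ pullback.fst A.X.hom (AbelianVariety.bcSpec ℂ L)) ≫
        AbelianVariety.Hom.toSchemeHom (A.phiTheta Θ hΘ) =
      (x.left ≫ AbelianVariety.Hom.toSchemeHom (AbelianVariety.Hom.baseChange L (A.phiTheta Θ hΘ))) ≫
        pullback.fst (A.dualOf Θ hΘ).X.hom (AbelianVariety.bcSpec ℂ L) :=
    ((Category.assoc _ _ _).trans
      (congrArg (x.left ≫ ·) (AbelianVariety.toSchemeHom_baseChange_comp_fst L (A.phiTheta Θ hΘ)).symm)).trans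
      (Category.assoc _ _ _).symm
  exact h1.trans (h2.trans ((congrArg (· ≫ pullback.fst (A.dualOf Θ hΘ).X.hom (AbelianVariety.bcSpec ℂ L)) hx').trans
    ((A.dualOf Θ hΘ).pointsEquiv_apply_left_comp_fst L b)))

variable {P : (A.prod (A.dualOf Θ hΘ)).X.left.Modules}
  (eP : Nonempty ((Scheme.Modules.pullback (AbelianVariety.Hom.toSchemeHom (A.oneProdPhiTheta hΘ))).obj P ≅
    mumfordSheaf A Θ))

include eP in
/-- **`𝒫|_{A_L × {b}} ∈ Pic⁰(A_L)`** for a line bundle `𝒫` on `A × Â` with `(1 × φ_Θ)^*𝒫 ≅ Λ(𝒪(Θ))` and a point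
`b : Spec L → Â` lying over the structure map `Spec L → Spec ℂ`, `L` algebraically closed, the slice
`S = (pr₁, b ∘ pr₂) : A_L → A × Â` being passed with its two defining equations: write `b = φ_Θ(a)` with `a ∈ A(L)`
(`exists_points_comp_phiTheta_eq`); then `S = (pr₁, a∘pr₂) ≫ (1 × φ_Θ)`, so `𝒫|S ≅ Λ(𝒪(Θ))|_{A_L × {a}}`, which
lies in `Pic⁰(A_L)` (`isHomogeneous_pullback_slice_mumfordSheaf`). [cite: MumfordAV1970, §8 (pp. 78–80)] [cite: MilneAV2008, I §8 (p. 37 (a), p. 40)] -/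
theorem isHomogeneous_pullback_slice_baseChange (L : Type) [Field L] [Algebra ℂ L] [IsAlgClosed L]
    (b : Spec (.of L) ⟶ (A.dualOf Θ hΘ).X.left) (hb : b ≫ (A.dualOf Θ hΘ).X.hom = AbelianVariety.bcSpec ℂ L)
    (S : (A.baseChange L).X.left ⟶ (A.X ⊗ (A.dualOf Θ hΘ).X).left)
    (hS₁ : S ≫ (fst A.X (A.dualOf Θ hΘ).X).left = pullback.fst A.X.hom (AbelianVariety.bcSpec ℂ L))
    (hS₂ : S ≫ (snd A.X (A.dualOf Θ hΘ).X).left = (A.baseChange L).X.hom ≫ b) :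
    IsHomogeneous (A.baseChange L) ((Scheme.Modules.pullback S).obj P) := by
  obtain ⟨e⟩ := eP
  obtain ⟨a, ha⟩ := exists_points_comp_phiTheta_eq A hΘ L (Over.homMk b hb)
  have ha' : a.left ≫ AbelianVariety.Hom.toSchemeHom (A.phiTheta Θ hΘ) = b := congrArg CommaMorphism.left ha
  -- the projections of `1 × φ_Θ`
  obtain ⟨F, hF⟩ : ∃ F : (A.X ⊗ A.X).left ⟶ (A.X ⊗ (A.dualOf Θ hΘ).X).left,
      F = AbelianVariety.Hom.toSchemeHom (A.oneProdPhiTheta hΘ) := ⟨_, rfl⟩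
  have hF₁ : F ≫ (fst A.X (A.dualOf Θ hΘ).X).left = (fst A.X A.X).left := by
    rw [hF]; exact congrArg CommaMorphism.left (A.oneProdPhiTheta_comp_fst hΘ)
  have hF₂ : F ≫ (snd A.X (A.dualOf Θ hΘ).X).left = (snd A.X A.X).left ≫ AbelianVariety.Hom.toSchemeHom (A.phiTheta Θ hΘ) := by
    rw [hF]; exact congrArg CommaMorphism.left (A.oneProdPhiTheta_comp_snd hΘ)
  -- the slice `G = (pr₁, a∘pr₂) : A_L → A × A` and the slice square `S = G ≫ (1 × φ_Θ)`
  obtain ⟨G, hG⟩ : ∃ G : (A.baseChange L).X.left ⟶ (A.X ⊗ A.X).left,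
      G = (lift (A.fstPt L) (A.constPt L a)).left := ⟨_, rfl⟩
  have hG₁ : G ≫ (fst A.X A.X).left = pullback.fst A.X.hom (AbelianVariety.bcSpec ℂ L) := by
    rw [hG]; exact congrArg CommaMorphism.left (lift_fst (A.fstPt L) (A.constPt L a))
  have hG₂ : G ≫ (snd A.X A.X).left = (A.baseChange L).X.hom ≫ a.left := by
    rw [hG]; exact congrArg CommaMorphism.left (lift_snd (A.fstPt L) (A.constPt L a))
  have hsq : S = G ≫ F := by
    apply pullback.hom_ext
    · change S ≫ (fst A.X (A.dualOf Θ hΘ).X).left = (G ≫ F) ≫ (fst A.X (A.dualOf Θ hΘ).X).left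
      rw [hS₁, Category.assoc, hF₁, hG₁]
    · change S ≫ (snd A.X (A.dualOf Θ hΘ).X).left = (G ≫ F) ≫ (snd A.X (A.dualOf Θ hΘ).X).left
      rw [hS₂, Category.assoc, hF₂, ← Category.assoc, hG₂, Category.assoc]
      exact (congrArg ((A.baseChange L).X.hom ≫ ·) ha').symm
  -- `𝒫|S ≅ G^* (1 × φ_Θ)^* 𝒫 ≅ Λ(𝒪(Θ))|_{A_L × {a}}`
  have j : (Scheme.Modules.pullback S).obj P ≅ (Scheme.Modules.pullback G).obj (mumfordSheaf A Θ) :=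
    (Scheme.Modules.pullbackCongr hsq).app P ≪≫ ((Scheme.Modules.pullbackComp G F).app P).symm ≪≫
      (Scheme.Modules.pullback G).mapIso (((Scheme.Modules.pullbackCongr hF).app P) ≪≫ e)
  exact (isHomogeneous_iff_of_iso _ j).2
    (isHomogeneous_pullback_slice_mumfordSheaf L A Θ a _ rfl G hG₁ hG₂)

include eP in
/-- **The Poincaré sheaf lies fibrewise in `Pic⁰` at every geometric point of `Â`** — the field `fibrewisePicZero`
of the tree's `AbelianSchemeOver.DualPair` for `A := ofAbelianVariety A`, `hat := ofAbelianVariety (A.dualOf Θ hΘ)`,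
`P := 𝒫`, VERBATIM: for every algebraically closed `Ω` and every `b : Spec Ω → Â`, the slice `𝒫|_{A_s × {b}}`
(`s = b ≫ π̂`, pulled back along ★ `fibreSlice`) is translation invariant on the abelian variety `A_s` over `Ω`
([MilneAV2008] I §8 (a) «`𝒫|_{A × {b}} ∈ Pic⁰(A_b)` for all `b`»; [MumfordAV1970] §8 (i)⇔(iv)).  Proof: present the
structure map `s` as `Spec σ` (`Spec` is fully faithful); then `A_s` IS the base change `A_L` for `L = Ω` regarded as a
`ℂ`-algebra through `σ` (★ `AlongHom`; definitionally) and the statement is `isHomogeneous_pullback_slice_baseChange`.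
[cite: MilneAV2008, I §8 (pp. 36–37 (a))] [cite: MumfordAV1970, §8 ((i) ⇔ (iv), pp. 74–80)] -/
theorem fibrewisePicZero_ofAbelianVariety_dualOf (Ω : Type) [Field Ω] [IsAlgClosed Ω]
    (b : Spec (.of Ω) ⟶ (AbelianSchemeOver.ofAbelianVariety (A.dualOf Θ hΘ)).X.left) :
    IsHomogeneous
      ((AbelianSchemeOver.ofAbelianVariety A).fibre
        (b ≫ (AbelianSchemeOver.ofAbelianVariety (A.dualOf Θ hΘ)).X.hom)).toAbelianVariety
      ((Scheme.Modules.pullback ((AbelianSchemeOver.ofAbelianVariety A).fibreSlice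
        (AbelianSchemeOver.ofAbelianVariety (A.dualOf Θ hΘ)) b)).obj P) := by
  -- generalise the base point `s = b ≫ π̂`, then present it as `Spec σ`
  suffices h : ∀ (s : Spec (.of Ω) ⟶ Spec (.of ℂ)) (b' : Spec (.of Ω) ⟶ (A.dualOf Θ hΘ).X.left)
      (hs : b' ≫ (A.dualOf Θ hΘ).X.hom = s),
      IsHomogeneous ((AbelianSchemeOver.ofAbelianVariety A).fibre s).toAbelianVariety
        ((Scheme.Modules.pullback
          (pullback.lift (pullback.fst A.X.hom s) (pullback.snd A.X.hom s ≫ b')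
            ((pullback.condition.trans (congrArg (pullback.snd A.X.hom s ≫ ·) hs.symm)).trans
              (Category.assoc _ _ _).symm) :
                pullback A.X.hom s ⟶ (A.prod (A.dualOf Θ hΘ)).X.left)).obj P) from
    h _ b rfl
  intro s b' hs
  obtain ⟨σ, rfl⟩ : ∃ σ : ℂ →+* Ω, Spec.map (CommRingCat.ofHom σ) = s := ⟨(Spec.preimage s).hom, Spec.map_preimage s⟩
  haveI : IsAlgClosed (AlongHom Ω σ) := ‹IsAlgClosed Ω›
  exact isHomogeneous_pullback_slice_baseChange A hΘ eP (AlongHom Ω σ) b' hs _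
    (pullback.lift_fst _ _ _) (pullback.lift_snd _ _ _)

end Complex

end Literature.AlgebraicGeometry.AbelianVarieties

end
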